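import Summits.RiemannHypothesis.RiemannHypothesis.Theorems.PfPersistenceGalerkinFormRadius
import Literature.NumberTheory.LFunctions.WeilArchModulatedGrowth
import HarnessLib

/-!
# PF persistence — GAL-0 piece (ii), STEP 5b: the archimedean integral of the cut-off
# autocorrelation as a function of the radius; `W(A_{b_n}) → W(A_c)` (pub-rhpf barrier-prover g2)

HONEST FRAMING: long-odds mechanism search; no RH claims.  Continues `…GalerkinFormRadius`.

For `f ∈ C¹(ℝ)`, `F_b = 1_{[-b,b]} f`, `A_b = F_b ⋆ F̃_b`, PROVED here (RH-free):

* `exists_weilArchIntegrand_autocorrAt_majorant` — for `b ∈ [0, B]` the archimedean integrand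
  `Â_b(½+it) · Re ψ(¼+it/2) = |F̂_b(½+it)|² Re ψ(¼+it/2)` is dominated by `K_B (1+|t|)^{-3/2}`
  (uniform IBP decay of `…Radius` and the digamma log bound `abs_re_digamma_quarter_le_log`);
* `integrable_weilArchIntegrand_autocorrAt` — hypothesis `hA` of the STEP-3c engine for `A_b`;
* `tendsto_weilArchIntegral_autocorrAt` (dominated convergence) and the assembled
  **`tendsto_weilFunctional_autocorrAt`**: `W(A_{b_n}) → W(A_c)` whenever `b_n → c` in `[0, B]`.
-/

set_option linter.dupNamespace false

noncomputable section

open Complex Filter Set MeasureTheory Topology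
open scoped Real ComplexConjugate

namespace Summit.RiemannHypothesis.RiemannHypothesis.Theorems.PfPersistence

open Literature.NumberTheory.LFunctions

variable {f f' : ℝ → ℂ}

/-- `F_b` is integrable for continuous `f`. [folklore] -/
theorem integrable_cutoffAt (hfc : Continuous f) (b : ℝ) : Integrable (cutoffAt b f) := by
  have h := integrable_cutoffAt_mul hfc b (w := fun _ ↦ (1 : ℂ)) continuous_const
  simpa using h

/-- The archimedean integrand of `A_b` is continuous in `t`. [folklore] -/
theorem continuous_weilArchIntegrand_autocorrAt (hfc : Continuous f) {b : ℝ} (hb : 0 ≤ b) :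
    Continuous fun t : ℝ ↦ weilMellin (autocorrAt b f) (1 / 2 + t * I) *
      ((Complex.digamma (1 / 4 + t / 2 * I)).re : ℂ) := by
  have heq : (fun t : ℝ ↦ weilMellin (autocorrAt b f) (1 / 2 + t * I)) =
      fun t : ℝ ↦ (Complex.normSq (weilMellin (cutoffAt b f) (1 / 2 + t * I)) : ℂ) :=
    funext fun t ↦ weilMellin_autocorr_half (integrable_cutoffAt hfc b) t
  have h1 : Continuous fun t : ℝ ↦ weilMellin (autocorrAt b f) (1 / 2 + t * I) := by
    rw [heq]
    exact continuous_ofReal.comp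
      (Complex.continuous_normSq.comp (continuous_weilMellin_cutoffAt_half hfc hb))
  exact h1.mul (continuous_ofReal.comp continuous_re_digamma_quarter_half)

/-- **Uniform majorant** of the archimedean integrand of `A_b`, `b ∈ [0, B]`. [folklore] -/
theorem exists_weilArchIntegrand_autocorrAt_majorant (hf : ∀ x, HasDerivAt f (f' x) x)
    (hf' : Continuous f') {B : ℝ} (hB : 0 ≤ B) :
    ∃ K : ℝ, 0 ≤ K ∧ ∀ b ∈ Icc 0 B, ∀ t : ℝ,
      ‖weilMellin (autocorrAt b f) (1 / 2 + t * I) * ((Complex.digamma (1 / 4 + t / 2 * I)).re : ℂ)‖ ≤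
        K * (1 + ‖t‖) ^ (-(3 / 2 : ℝ)) := by
  have hfc : Continuous f := continuous_iff_continuousAt.2 fun x ↦ (hf x).continuousAt
  obtain ⟨C, hC0, hC⟩ := exists_norm_weilMellin_cutoffAt_half_le hf hf' hB
  refine ⟨C ^ 2 * 16, by positivity, fun b hb t ↦ ?_⟩
  rw [norm_mul, norm_weilMellin_autocorr_half (integrable_cutoffAt hfc b)]
  have hu : 0 < 1 + |t| := by positivity
  have hs1 : 1 ≤ (1 + |t|) ^ (1 / 2 : ℝ) :=
    Real.one_le_rpow (by linarith [abs_nonneg t]) (by norm_num)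
  -- the digamma weight: `|Re ψ(¼+it/2)| ≤ log(3+|t|) + 12 ≤ 16 (1+|t|)^{1/2}`
  have hψ : ‖((Complex.digamma (1 / 4 + t / 2 * I)).re : ℂ)‖ ≤ 16 * (1 + |t|) ^ (1 / 2 : ℝ) := by
    rw [Complex.norm_real, Real.norm_eq_abs]
    have h1 := abs_re_digamma_quarter_le_log t
    have hlog3 : Real.log (3 + |t|) ≤ Real.log 3 + Real.log (1 + |t|) := by
      rw [← Real.log_mul (by norm_num) (by positivity)]
      exact Real.log_le_log (by positivity) (by linarith [abs_nonneg t])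
    have hl3 : Real.log 3 ≤ 2 := by
      have := Real.log_le_sub_one_of_pos (show (0 : ℝ) < 3 by norm_num)
      linarith
    have hlog : Real.log (1 + |t|) ≤ 2 * (1 + |t|) ^ (1 / 2 : ℝ) := by
      have h := Real.log_le_rpow_div (x := 1 + |t|) (ε := 1 / 2) (by positivity) (by norm_num)
      calc Real.log (1 + |t|) ≤ (1 + |t|) ^ (1 / 2 : ℝ) / (1 / 2) := h
        _ = 2 * (1 + |t|) ^ (1 / 2 : ℝ) := by ring
    linarith
  have hsq : ‖weilMellin (cutoffAt b f) (1 / 2 + t * I)‖ ^ 2 ≤ (C / (1 + |t|)) ^ 2 :=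
    pow_le_pow_left₀ (norm_nonneg _) (hC b hb t) 2
  have hrpow : (C / (1 + |t|)) ^ 2 * (16 * (1 + |t|) ^ (1 / 2 : ℝ)) =
      C ^ 2 * 16 * (1 + ‖t‖) ^ (-(3 / 2 : ℝ)) := by
    rw [Real.norm_eq_abs, div_pow]
    have hu' : (1 + |t|) ^ 2 = (1 + |t|) ^ (2 : ℝ) := by norm_cast
    rw [hu']
    have e1 : (1 + |t|) ^ (-(3 / 2 : ℝ)) = (1 + |t|) ^ (1 / 2 : ℝ) / (1 + |t|) ^ (2 : ℝ) := by
      rw [← Real.rpow_sub hu]; norm_num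
    rw [e1]
    field_simp
  calc ‖weilMellin (cutoffAt b f) (1 / 2 + t * I)‖ ^ 2 *
        ‖((Complex.digamma (1 / 4 + t / 2 * I)).re : ℂ)‖
      ≤ (C / (1 + |t|)) ^ 2 * (16 * (1 + |t|) ^ (1 / 2 : ℝ)) :=
        mul_le_mul hsq hψ (norm_nonneg _) (by positivity)
    _ = C ^ 2 * 16 * (1 + ‖t‖) ^ (-(3 / 2 : ℝ)) := hrpow

/-- The majorant `K (1+|t|)^{-3/2}` is integrable. [folklore] -/
theorem integrable_majorant_threeHalves (K : ℝ) :
    Integrable fun t : ℝ ↦ K * (1 + ‖t‖) ^ (-(3 / 2 : ℝ)) :=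
  (integrable_one_add_norm (E := ℝ) (μ := volume) (r := 3 / 2)
    (by rw [Module.finrank_self]; norm_num)).const_mul K

/-- **The archimedean integrand of `A_b` is integrable** (`b ≥ 0`): hypothesis `hA` of
`tendsto_weilFunctional_mollSq` for `g := A_b`. [folklore] -/
theorem integrable_weilArchIntegrand_autocorrAt (hf : ∀ x, HasDerivAt f (f' x) x)
    (hf' : Continuous f') {b : ℝ} (hb : 0 ≤ b) :
    Integrable fun t : ℝ ↦ weilMellin (autocorrAt b f) (1 / 2 + t * I) *
      ((Complex.digamma (1 / 4 + t / 2 * I)).re : ℂ) := by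
  have hfc : Continuous f := continuous_iff_continuousAt.2 fun x ↦ (hf x).continuousAt
  obtain ⟨K, -, hK⟩ := exists_weilArchIntegrand_autocorrAt_majorant hf hf' hb
  exact (integrable_majorant_threeHalves K).mono'
    (continuous_weilArchIntegrand_autocorrAt hfc hb).aestronglyMeasurable
    (Eventually.of_forall fun t ↦ hK b ⟨hb, le_rfl⟩ t)

/-- **Archimedean integral**: `∫ Â_{b_n}(½+it) Re ψ dt → ∫ Â_c(½+it) Re ψ dt` for `b_n → c` in
`[0, B]` (dominated convergence). [folklore] -/
theorem tendsto_weilArchIntegral_autocorrAt (hf : ∀ x, HasDerivAt f (f' x) x) (hf' : Continuous f')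
    {b : ℕ → ℝ} {B : ℝ} (hb : ∀ n, b n ∈ Icc 0 B) {c : ℝ} (hc : c ∈ Icc 0 B)
    (hlim : Tendsto b atTop (𝓝 c)) :
    Tendsto (fun n ↦ weilArchIntegral (autocorrAt (b n) f)) atTop
      (𝓝 (weilArchIntegral (autocorrAt c f))) := by
  have hfc : Continuous f := continuous_iff_continuousAt.2 fun x ↦ (hf x).continuousAt
  have hB : 0 ≤ B := hc.1.trans hc.2
  obtain ⟨K, -, hK⟩ := exists_weilArchIntegrand_autocorrAt_majorant hf hf' hB
  unfold weilArchIntegral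
  refine tendsto_integral_of_dominated_convergence (fun t : ℝ ↦ K * (1 + ‖t‖) ^ (-(3 / 2 : ℝ)))
    (fun n ↦ (continuous_weilArchIntegrand_autocorrAt hfc (hb n).1).aestronglyMeasurable)
    (integrable_majorant_threeHalves K) (fun n ↦ Eventually.of_forall fun t ↦ hK _ (hb n) t)
    (Eventually.of_forall fun t ↦ ?_)
  have e : ∀ b' : ℝ, weilMellin (autocorrAt b' f) (1 / 2 + t * I) =
      (Complex.normSq (weilMellin (cutoffAt b' f) (1 / 2 + t * I)) : ℂ) :=
    fun b' ↦ weilMellin_autocorr_half (integrable_cutoffAt hfc b') t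
  simp only [e]
  exact (((continuous_ofReal.comp Complex.continuous_normSq).tendsto _).comp
    (tendsto_weilMellin_cutoffAt hfc (fun n ↦ (hb n).1) hc.1 hlim _)).mul_const _

/-- **`W(A_{b_n}) → W(A_c)`** for `b_n → c` in `[0, B]`, `f ∈ C¹`. [folklore] -/
theorem tendsto_weilFunctional_autocorrAt (hf : ∀ x, HasDerivAt f (f' x) x) (hf' : Continuous f')
    {b : ℕ → ℝ} {B : ℝ} (hb : ∀ n, b n ∈ Icc 0 B) {c : ℝ} (hc : c ∈ Icc 0 B)
    (hlim : Tendsto b atTop (𝓝 c)) :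
    Tendsto (fun n ↦ weilFunctional (autocorrAt (b n) f)) atTop
      (𝓝 (weilFunctional (autocorrAt c f))) := by
  have hfc : Continuous f := continuous_iff_continuousAt.2 fun x ↦ (hf x).continuousAt
  have hP := tendsto_weilPolarTerm_autocorrAt hfc (fun n ↦ (hb n).1) hc.1 hlim
  have hPr := tendsto_weilPrimeTerm_autocorrAt hfc (fun n ↦ (hb n).2) hc.2 hlim
  have hA := tendsto_weilArchIntegral_autocorrAt hf hf' hb hc hlim
  have h0 := tendsto_autocorrAt_apply hfc hlim 0
  unfold weilFunctional weilArchTerm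
  exact (hP.sub hPr).add ((hA.const_mul _).sub (h0.mul_const _))

/-- **Mass and form along a radius sequence**, packaged: for `b_n → c` in `[0, B]`,
`W(A_{b_n}) → W(A_c)` and `∫‖F_{b_n}‖² → ∫‖F_c‖²`. [folklore] -/
theorem tendsto_form_and_mass_cutoffAt (hf : ∀ x, HasDerivAt f (f' x) x) (hf' : Continuous f')
    {b : ℕ → ℝ} {B : ℝ} (hb : ∀ n, b n ∈ Icc 0 B) {c : ℝ} (hc : c ∈ Icc 0 B)
    (hlim : Tendsto b atTop (𝓝 c)) :
    Tendsto (fun n ↦ weilFunctional (autocorrAt (b n) f)) atTop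
        (𝓝 (weilFunctional (autocorrAt c f))) ∧
      Tendsto (fun n ↦ ∫ t, ‖cutoffAt (b n) f t‖ ^ 2) atTop (𝓝 (∫ t, ‖cutoffAt c f t‖ ^ 2)) :=
  ⟨tendsto_weilFunctional_autocorrAt hf hf' hb hc hlim,
    tendsto_integral_norm_sq_cutoffAt (continuous_iff_continuousAt.2 fun x ↦ (hf x).continuousAt)
      (fun n ↦ (hb n).1) hc.1 hlim⟩

end Summit.RiemannHypothesis.RiemannHypothesis.Theorems.PfPersistence
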